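import Summits.HodgeConjecture.HodgeConjecture.Theorems.VHCAbelianSchemesRoadSecantQuotientHyperellipticLevelTransferDefs
import Summits.HodgeConjecture.HodgeConjecture.Theorems.VHCAbelianSchemesRoadLocallyServedAnchorCarriedPair
import HarnessLib

/-!
# Road b02 (`VHCAbelianSchemesRoad`, D-0059) — skeleton v3.6 = D1 of crux `SemiregularSheafRepresentativesTwPrimeAtDiagLocal` (item
# stmt-HodgeConjecture-23176), stub 2a′₀ `stub_oneCarried_63_secantQuotientPinnedPrime`: the stub IS print's pinned claim L1″ plus the
# already-named one-direction same-level transfer node G1♭′ — EXACTLY (fact-free glue, hypothesis form)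

research route conditional on HC_CM; not a corollary; Q11.4-sentence-2 already refuted in dim ≥ 3.

THEOREMS ONLY (no definition, no new named fact, no sorry; `HC_CM` nowhere; nothing of an existing file is edited). ring2-b03x gen 8, plate of
director-hodge g12 RULING R12.3 (4) ∕ LEAD 160 START-HERE (ring2 INBOX 2026-08-28T00:17:27Z): «close 2a′₀ in kernel from L1″ BY NAME + p584635 +
p587622, or land the exact missing implication as ONE named helper»; `--supports stmt-HodgeConjecture-23176`.

THE READING, KERNEL-CHECKED. The registered stub 2a′₀ (skeleton `Cruxes/SemiregularSheafRepresentativesTwPrimeAtDiagLocal/Lines/birth.lean`, sha16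
d90a822216f4b6c6, l.74) says: at EVERY pinned secant–quotient anchor `(Y, θ)` (`secantQuotientAnchorsPinned`: a chart of ANY `SecantQuotientDatum` —
any genus-3 curve whose Jacobian carries a Riemann theta divisor, hyperelliptic ones included, any admissible level pair, any pin) SOME pinned-served
class is carried by a `tw C AdmTw′`-datum (`γ₁ ∈ AbelianAll.carriedClasses (tw C AdmTw′) 6 3 Y θ`). Print's pinned claim L1″
(`HodgeTheory.Markman2025_secantQuotient_twistedCarrier_onJacobian_pinned C Adm`, PREPRINT arXiv:2502.03415, HYPOTHESIS FORM ONLY) is an ∃-statement over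
print's construction data: read road-side (`exists_carried_secantQuotientPinned_of_pinned`, p-numbered file `…SecantQuotientAnchorPinnedPrimeMarkman`) it
SEEDS every even level `d ≥ 4` with ONE level-`d` pinned anchor carrying a pinned-served class — it never speaks about the other anchors of the level.
So «L1″ ⟹ 2a′₀» holds iff carried-ness of SOME pinned-served class TRAVELS from the seeded anchor to every PINNED anchor of the same level; and that
one-direction same-level transfer is ALREADY A NAMED NODE of the tree: **G1♭ = `SecantQuotientPinnedAnchorLevelTransfer63 𝒪`** (lane R,
`…SecantQuotientPinnedLevelTransferDefs`, ring2-b03 g87; primed instance `SecantQuotientPinnedAnchorLevelTransfer63PinnedPrime C`; its two halves across the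
hyperelliptic divisor `…OffHyperelliptic` ∕ `…AtHyperelliptic`, `…SecantQuotientHyperellipticLevelTransferDefs`). This file proves, fact-free:

* §1 (door-generic, any `𝒪 : ObjClass`): **seeds ∧ G1♭ ⟹ the 2a′₀-body** (`oneCarried_63_pinned_of_seeds_of_pinnedLevelTransfer63`: a pinned anchor has
  an even level `d ≥ 4` — `exists_isSecantQuotientAnchorWith_of_secantQuotientAnchorsPinned` —, that level is seeded, transfer); **the 2a′₀-body ⟹ G1♭
  OUTRIGHT** (`pinnedLevelTransfer63_of_oneCarried_63_pinned`: G1♭'s conclusion holds at every pinned target, source idle); hence **modulo the seeds,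
  2a′₀-body ⟺ G1♭** (`oneCarried_63_pinned_iff_pinnedLevelTransfer63_of_seeds`) — the one-direction sibling of
  `anchoredCarrierAt_secantQuotientPinned_iff_transfer_of_seeds` (all directions ⟺ ring2-b03x's node). Variants from the stronger named inputs: G1
  (`SecantQuotientAnchorLevelTransfer63`), the node (`SecantQuotientWeilDirectionTransfer63`), Off ∧ At (hyperelliptic split), and — with NO seed — the
  all-directions anchored-carrier statement `AnchoredCarrierAt 𝒪 6 3 𝔄^pin 𝔖^pin` (v3.3's 2a‴ shape).
* §2 (any `Adm`): L1″(C, Adm) supplies the seeds, so **L1″(C, Adm) ∧ G1♭(tw C Adm) ⟹ 2a′₀-body at `tw C Adm`**, and modulo L1″(C, Adm) the two are equivalent.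
* §3 (the literal primed door of the registered stub): **`oneCarried_63_twPrime_of_markmanPinned_of_pinnedLevelTransfer` :
  L1″(C, AdmTw′) → `SecantQuotientPinnedAnchorLevelTransfer63PinnedPrime C` → ‹2a′₀'s statement at `C`, verbatim›**; the converse
  `pinnedLevelTransfer63PinnedPrime_of_oneCarried_63_twPrime` (no L1″ needed); **modulo L1″(C, AdmTw′): 2a′₀(C) ⟺ G1♭′(C)**
  (`oneCarried_63_twPrime_iff_pinnedLevelTransfer63PinnedPrime_of_markmanPinned`); the `∀ C` form with the registered stub's TYPE as conclusion
  (`forall_oneCarried_63_twPrime_of_markmanPinned_of_pinnedLevelTransfer`, syntactic guard); the variants via G1′, the primed node, Off′ ∧ At′, and 2a‴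
  (`SecantQuotientAnchorCarrier63PinnedPrime C ⟹ 2a′₀(C)`, unconditional).
* §4 the F7 chain of skeleton v3.6 keyed by name: **L1″(C, AdmTw′) ∧ G1♭′(C) ∧ 2m′(C) ⟹ 2s′(C)** by ring2-b03x g7's
  `anchoredSpanAt_pinned_twPrime_of_oneCarried_of_secondCarried` (p587622).

VERDICT WORDS (honest): 2a′₀ is NOT closed and is NOT derivable from L1″ by name; kernel-side 2a′₀ = L1″(C, AdmTw′) ∧ G1♭′(C) EXACTLY, and G1♭′ —
closedness of carried-ness across the anchors print does not construct (hyperelliptic curves: Markman assumes `C` non-hyperelliptic, §9 p. 57;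
Prop. 9.2.2's reflexivity and Lemma 9.3.11's rank-6 obstruction map use it) — is NOT IN PRINT; OPEN. No new signature is needed for the LEAD: the
gap's signature is the tree's `SecantQuotientPinnedAnchorLevelTransfer63PinnedPrime` (its hyperelliptic half `…AtHyperellipticPinnedPrime` is the research
content, its off-hyperelliptic half is print read in ∀-form, citation-expected but also not typed as a fact).

Nothing here says L1″, G1, G1♭, Off, At, the node, 2a‴, 2a′₀, 2m′, 2s′, any cell, the crux, K-SR♭∃, VHC, `HC_AV`, `HC_CM` or HC holds; HC_CM HELD, by
name only; typed ≠ proved. References: [cite: Markman2025SecantWeil, §1.3 (p. 5), §1.5 (p. 7), Thm. 1.4.1 (item 4), Thm. 1.5.1, §9 (p. 57), §9.2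
Prop. 9.2.2, §9.3 Lemma 9.3.1 and Lemma 9.3.11] [cite: Bloch1972Semiregularity, Remark (7.5)] [cite: BuchweitzFlenner2003, §5 Thm. 5.1]
[cite: Pridham2024Semiregularity, Cor. 2.25 and Rem. 2.26] [cite: vanGeemen1994HodgeAV, Lemma 5.2, 5.4 and Thm. 4.11].
-/

noncomputable section

open CategoryTheory CategoryTheory.Limits AlgebraicGeometry Topology

namespace Summit.HodgeConjecture.HodgeConjecture.Ring2.SemiregularRepresentatives

set_option linter.dupNamespace false -- the cell's namespace repeats the summit name, as in every `Ring2*` file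

open Literature.AlgebraicGeometry Literature.AlgebraicGeometry.Motives Literature.AlgebraicGeometry.Motives.AbelianVariety
open Literature.AlgebraicGeometry.HodgeTheory Literature.AlgebraicGeometry.Markman2025
open Literature.AlgebraicTopology.SingularHomology
open Summit.Ventures.HSemireg (ObjClass)
open Summit.HodgeConjecture.HodgeConjecture.Ring2.AbelianAll (carriedClasses)

/-! ## §1 Door-generic: seeds ∧ G1♭ ⟹ one carried pinned-served class at every pinned anchor; the converse outright -/

section Generic

variable {𝒪 : ObjClass}

/-- **SEEDS ∧ G1♭ ⟹ THE 2a′₀-BODY** (door-generic, fact-free): if every even level `d ≥ 4` is SEEDED — some level-`d` anchor with its class `(X', θ')`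
(`Markman2025.IsSecantQuotientAnchorWith d`) carries an `𝒪`-datum in some rational pinned-served direction — and carried-ness of some rational
pinned-served class transfers to every PINNED anchor of the same level (`SecantQuotientPinnedAnchorLevelTransfer63 𝒪`, G1♭), then at every pinned
anchor `(Y, θ)` some pinned-served class is `𝒪`-carried: a pinned anchor has the (even, `≥ 4`) level of its datum
(`exists_isSecantQuotientAnchorWith_of_secantQuotientAnchorsPinned`), that level is seeded, transfer.
[cite: Markman2025SecantWeil, §1.5 (p. 7), Thm. 1.4.1 (item 4) and Thm. 1.5.1] [cite: Bloch1972Semiregularity, Remark (7.5)] -/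
theorem oneCarried_63_pinned_of_seeds_of_pinnedLevelTransfer63
    (hseed : ∀ d : ℕ, Even d → 4 ≤ d →
      ∃ (X' : SchemeOver ℂ) (θ' : complexBetti X' 2) (w' : complexBetti X' (2 * 3)),
        IsSecantQuotientAnchorWith d X' θ' ∧ w' ∈ secantQuotientServedClassesPinned X' θ' ∧ IsRationalClass w' ∧
        w' ∈ carriedClasses 𝒪 6 3 X' θ')
    (hG1 : SecantQuotientPinnedAnchorLevelTransfer63 𝒪) :
    ∀ (Y : SchemeOver ℂ) (θ : complexBetti Y 2), secantQuotientAnchorsPinned Y θ →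
      ∃ γ₁ ∈ secantQuotientServedClassesPinned Y θ, γ₁ ∈ carriedClasses 𝒪 6 3 Y θ := by
  intro Y θ hpin
  obtain ⟨d, hd, h4, hYd⟩ := exists_isSecantQuotientAnchorWith_of_secantQuotientAnchorsPinned hpin
  obtain ⟨X', θ', w', hX'd, hw', hw'Q, hw'c⟩ := hseed d hd h4
  obtain ⟨w, hw, -, hwc⟩ := hG1 d hYd hpin hX'd ⟨w', hw', hw'Q, hw'c⟩
  exact ⟨w, hw, hwc⟩

/-- **THE 2a′₀-BODY ⟹ G1♭, OUTRIGHT** (no seed, the source anchor is idle): G1♭'s conclusion «some rational pinned-served class is carried at the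
pinned target» is the 2a′₀-body at that target (pinned-served classes are rational by definition). So «2a′₀ = seeds ∧ G1♭» loses nothing.
[cite: Markman2025SecantWeil, Thm. 1.4.1 (item 4)] [cite: Bloch1972Semiregularity, Remark (7.5)] -/
theorem pinnedLevelTransfer63_of_oneCarried_63_pinned
    (h : ∀ (Y : SchemeOver ℂ) (θ : complexBetti Y 2), secantQuotientAnchorsPinned Y θ →
      ∃ γ₁ ∈ secantQuotientServedClassesPinned Y θ, γ₁ ∈ carriedClasses 𝒪 6 3 Y θ) :
    SecantQuotientPinnedAnchorLevelTransfer63 𝒪 := by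
  intro d Y X' θ θ' _ hpin _ _
  obtain ⟨w, hw, hwc⟩ := h Y θ hpin
  exact ⟨w, hw, IsSecantQuotientWeilClassAtPinned.isRationalClass hw, hwc⟩

/-- **Modulo the seeds, the 2a′₀-body ⟺ G1♭** — the ONE-DIRECTION sibling of `anchoredCarrierAt_secantQuotientPinned_iff_transfer_of_seeds` (there:
the all-directions anchored-carrier statement ⟺ ring2-b03x's node). [cite: Markman2025SecantWeil, Thm. 1.4.1 (item 4) and Thm. 1.5.1]
[cite: Bloch1972Semiregularity, Remark (7.5)] -/
theorem oneCarried_63_pinned_iff_pinnedLevelTransfer63_of_seeds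
    (hseed : ∀ d : ℕ, Even d → 4 ≤ d →
      ∃ (X' : SchemeOver ℂ) (θ' : complexBetti X' 2) (w' : complexBetti X' (2 * 3)),
        IsSecantQuotientAnchorWith d X' θ' ∧ w' ∈ secantQuotientServedClassesPinned X' θ' ∧ IsRationalClass w' ∧
        w' ∈ carriedClasses 𝒪 6 3 X' θ') :
    (∀ (Y : SchemeOver ℂ) (θ : complexBetti Y 2), secantQuotientAnchorsPinned Y θ →
      ∃ γ₁ ∈ secantQuotientServedClassesPinned Y θ, γ₁ ∈ carriedClasses 𝒪 6 3 Y θ) ↔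
      SecantQuotientPinnedAnchorLevelTransfer63 𝒪 :=
  ⟨pinnedLevelTransfer63_of_oneCarried_63_pinned, oneCarried_63_pinned_of_seeds_of_pinnedLevelTransfer63 hseed⟩

/-- Seeds ∧ G1 (`SecantQuotientAnchorLevelTransfer63 𝒪`, lane R's node with unrestricted targets) ⟹ the 2a′₀-body (G1 ⟹ G1♭,
`pinnedLevelTransfer63_of_levelTransfer63`). [cite: Markman2025SecantWeil, Thm. 1.4.1 (item 4) and Thm. 1.5.1] [cite: Bloch1972Semiregularity, Remark (7.5)] -/
theorem oneCarried_63_pinned_of_seeds_of_levelTransfer63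
    (hseed : ∀ d : ℕ, Even d → 4 ≤ d →
      ∃ (X' : SchemeOver ℂ) (θ' : complexBetti X' 2) (w' : complexBetti X' (2 * 3)),
        IsSecantQuotientAnchorWith d X' θ' ∧ w' ∈ secantQuotientServedClassesPinned X' θ' ∧ IsRationalClass w' ∧
        w' ∈ carriedClasses 𝒪 6 3 X' θ')
    (hG1 : SecantQuotientAnchorLevelTransfer63 𝒪) :
    ∀ (Y : SchemeOver ℂ) (θ : complexBetti Y 2), secantQuotientAnchorsPinned Y θ →
      ∃ γ₁ ∈ secantQuotientServedClassesPinned Y θ, γ₁ ∈ carriedClasses 𝒪 6 3 Y θ :=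
  oneCarried_63_pinned_of_seeds_of_pinnedLevelTransfer63 hseed (pinnedLevelTransfer63_of_levelTransfer63 hG1)

/-- Seeds ∧ ring2-b03x's all-directions node (`SecantQuotientWeilDirectionTransfer63 𝒪` = G1♭ ∧ G3) ⟹ the 2a′₀-body (node ⟹ G1♭,
`pinnedLevelTransfer63_of_weilDirectionTransfer63`). [cite: Markman2025SecantWeil, Thm. 1.4.1 (item 4) and Thm. 1.5.1] [cite: Bloch1972Semiregularity, Remark (7.5)] -/
theorem oneCarried_63_pinned_of_seeds_of_weilDirectionTransfer63
    (hseed : ∀ d : ℕ, Even d → 4 ≤ d →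
      ∃ (X' : SchemeOver ℂ) (θ' : complexBetti X' 2) (w' : complexBetti X' (2 * 3)),
        IsSecantQuotientAnchorWith d X' θ' ∧ w' ∈ secantQuotientServedClassesPinned X' θ' ∧ IsRationalClass w' ∧
        w' ∈ carriedClasses 𝒪 6 3 X' θ')
    (hN : SecantQuotientWeilDirectionTransfer63 𝒪) :
    ∀ (Y : SchemeOver ℂ) (θ : complexBetti Y 2), secantQuotientAnchorsPinned Y θ →
      ∃ γ₁ ∈ secantQuotientServedClassesPinned Y θ, γ₁ ∈ carriedClasses 𝒪 6 3 Y θ :=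
  oneCarried_63_pinned_of_seeds_of_pinnedLevelTransfer63 hseed (pinnedLevelTransfer63_of_weilDirectionTransfer63 hN)

/-- Seeds ∧ the two halves of G1♭ across the hyperelliptic divisor (`…OffHyperelliptic` = print's territory read in ∀-form, `…AtHyperelliptic` = the
first honest closedness case) ⟹ the 2a′₀-body (`pinnedLevelTransfer63_of_offHyperelliptic_of_atHyperelliptic`).
[cite: Markman2025SecantWeil, §9 (p. 57), Thm. 1.4.1 (item 4) and §9.3 Lemma 9.3.11] [cite: Bloch1972Semiregularity, Remark (7.5)] -/
theorem oneCarried_63_pinned_of_seeds_of_offHyperelliptic_of_atHyperelliptic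
    (hseed : ∀ d : ℕ, Even d → 4 ≤ d →
      ∃ (X' : SchemeOver ℂ) (θ' : complexBetti X' 2) (w' : complexBetti X' (2 * 3)),
        IsSecantQuotientAnchorWith d X' θ' ∧ w' ∈ secantQuotientServedClassesPinned X' θ' ∧ IsRationalClass w' ∧
        w' ∈ carriedClasses 𝒪 6 3 X' θ')
    (hoff : SecantQuotientPinnedAnchorLevelTransfer63OffHyperelliptic 𝒪)
    (hat : SecantQuotientPinnedAnchorLevelTransfer63AtHyperelliptic 𝒪) :
    ∀ (Y : SchemeOver ℂ) (θ : complexBetti Y 2), secantQuotientAnchorsPinned Y θ →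
      ∃ γ₁ ∈ secantQuotientServedClassesPinned Y θ, γ₁ ∈ carriedClasses 𝒪 6 3 Y θ :=
  oneCarried_63_pinned_of_seeds_of_pinnedLevelTransfer63 hseed (pinnedLevelTransfer63_of_offHyperelliptic_of_atHyperelliptic hoff hat)

/-- **The all-directions anchored-carrier statement at the pinned data ⟹ the 2a′₀-body, with NO seed** (v3.3's 2a‴ shape is the stronger
single-carrier form): a pinned anchor HAS a pinned-served class — its witness, rational by definition —, which `AnchoredCarrierAt 𝒪 6 3 𝔄^pin 𝔖^pin`
carries. [cite: Markman2025SecantWeil, Thm. 1.4.1 (item 4)] [cite: Bloch1972Semiregularity, Remark (7.5)] -/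
theorem oneCarried_63_pinned_of_anchoredCarrierAt_pinned
    (h : AnchoredCarrierAt 𝒪 6 3 (fun X θ ↦ secantQuotientAnchorsPinned X θ) (fun X θ ↦ secantQuotientServedClassesPinned X θ)) :
    ∀ (Y : SchemeOver ℂ) (θ : complexBetti Y 2), secantQuotientAnchorsPinned Y θ →
      ∃ γ₁ ∈ secantQuotientServedClassesPinned Y θ, γ₁ ∈ carriedClasses 𝒪 6 3 Y θ := by
  intro Y θ hpin
  obtain ⟨γ, hγ⟩ := hpin
  exact ⟨γ, hγ, h Y θ ⟨γ, hγ⟩ γ hγ (IsSecantQuotientWeilClassAtPinned.isRationalClass hγ)⟩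

end Generic

/-! ## §2 With print's pinned claim L1″(C, Adm) as the seed supply (any admissibility notion `Adm`) -/

section Markman

variable {C : ChernCharacterBetti} {Adm : PerfectAdmissibility}

/-- **L1″(C, Adm) ∧ G1♭(tw C Adm) ⟹ THE 2a′₀-BODY AT THE DOOR `tw C Adm`**: print seeds every even level `d ≥ 4`
(`exists_carried_secantQuotientPinned_of_pinned`), G1♭ moves the carried pinned-served class to every pinned anchor of the level.
[cite: Markman2025SecantWeil, §1.5 (p. 7), Thm. 1.4.1 (item 4), Thm. 1.5.1 and §9.3 Lemma 9.3.11] [cite: Bloch1972Semiregularity, Remark (7.5)] -/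
theorem oneCarried_63_pinned_of_markmanPinned_of_pinnedLevelTransfer63
    (hM : Markman2025_secantQuotient_twistedCarrier_onJacobian_pinned C Adm)
    (hG1 : SecantQuotientPinnedAnchorLevelTransfer63 (twistedReflexiveClass C Adm)) :
    ∀ (Y : SchemeOver ℂ) (θ : complexBetti Y 2), secantQuotientAnchorsPinned Y θ →
      ∃ γ₁ ∈ secantQuotientServedClassesPinned Y θ, γ₁ ∈ carriedClasses (twistedReflexiveClass C Adm) 6 3 Y θ :=
  oneCarried_63_pinned_of_seeds_of_pinnedLevelTransfer63
    (fun d hd h4 ↦ by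
      obtain ⟨X', θ', w', hX', hw', hw'Q, -, hw'c⟩ := exists_carried_secantQuotientPinned_of_pinned hM hd h4
      exact ⟨X', θ', w', hX', hw', hw'Q, hw'c⟩)
    hG1

/-- **Modulo L1″(C, Adm): the 2a′₀-body at `tw C Adm` ⟺ G1♭(tw C Adm)** — the stub is print plus exactly this node.
[cite: Markman2025SecantWeil, Thm. 1.4.1 (item 4), §1.5 and Thm. 1.5.1] [cite: Bloch1972Semiregularity, Remark (7.5)] -/
theorem oneCarried_63_pinned_iff_pinnedLevelTransfer63_of_markmanPinned
    (hM : Markman2025_secantQuotient_twistedCarrier_onJacobian_pinned C Adm) :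
    (∀ (Y : SchemeOver ℂ) (θ : complexBetti Y 2), secantQuotientAnchorsPinned Y θ →
      ∃ γ₁ ∈ secantQuotientServedClassesPinned Y θ, γ₁ ∈ carriedClasses (twistedReflexiveClass C Adm) 6 3 Y θ) ↔
      SecantQuotientPinnedAnchorLevelTransfer63 (twistedReflexiveClass C Adm) :=
  ⟨pinnedLevelTransfer63_of_oneCarried_63_pinned, oneCarried_63_pinned_of_markmanPinned_of_pinnedLevelTransfer63 hM⟩

end Markman

/-! ## §3 At the literal primed door `tw C AdmTw′` of the registered stub 2a′₀ -/

section TwPrime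

/-- **THE NAMED HELPER OF THE PLATE — stub 2a′₀ from print and the one-direction transfer node, BY NAME:
L1″(C, AdmTw′) ⟹ G1♭′(C) ⟹ ‹`stub_oneCarried_63_secantQuotientPinnedPrime`'s statement at `C`, verbatim›.** Both inputs are OPEN statements and
hypotheses here (L1″: PREPRINT arXiv:2502.03415, under review, hypothesis form only; G1♭′ = `SecantQuotientPinnedAnchorLevelTransfer63PinnedPrime C`: NOT
in print — closedness of carried-ness at the anchors print does not construct, e.g. hyperelliptic curves). Nothing here says either holds.
[cite: Markman2025SecantWeil, §1.5 (p. 7), Thm. 1.4.1 (item 4), Thm. 1.5.1, §9 (p. 57) and §9.3 Lemma 9.3.11] [cite: Bloch1972Semiregularity, Remark (7.5)]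
[cite: BuchweitzFlenner2003, §5 Thm. 5.1] [cite: Pridham2024Semiregularity, Cor. 2.25 and Rem. 2.26] -/
theorem oneCarried_63_twPrime_of_markmanPinned_of_pinnedLevelTransfer (C : ChernCharacterBetti)
    (hM : Markman2025_secantQuotient_twistedCarrier_onJacobian_pinned C
      (fun n X₀ I E => Summit.Ventures.HSemireg.gluableSigmaAdmissible n X₀ I E ∨ bfSingleAdmissible' n X₀ I E))
    (hG1 : SecantQuotientPinnedAnchorLevelTransfer63PinnedPrime C) :
    ∀ (Y : SchemeOver ℂ) (θ : complexBetti Y 2), secantQuotientAnchorsPinned Y θ →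
      ∃ γ₁ ∈ secantQuotientServedClassesPinned Y θ,
        γ₁ ∈ Summit.HodgeConjecture.HodgeConjecture.Ring2.AbelianAll.carriedClasses
          (twistedReflexiveClass C (fun n X₀ I E => Summit.Ventures.HSemireg.gluableSigmaAdmissible n X₀ I E ∨ bfSingleAdmissible' n X₀ I E)) 6 3 Y θ :=
  oneCarried_63_pinned_of_markmanPinned_of_pinnedLevelTransfer63 hM hG1

/-- **2a′₀(C) ⟹ G1♭′(C), outright** (no L1″). [cite: Markman2025SecantWeil, Thm. 1.4.1 (item 4)] [cite: Bloch1972Semiregularity, Remark (7.5)] -/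
theorem pinnedLevelTransfer63PinnedPrime_of_oneCarried_63_twPrime (C : ChernCharacterBetti)
    (h : ∀ (Y : SchemeOver ℂ) (θ : complexBetti Y 2), secantQuotientAnchorsPinned Y θ →
      ∃ γ₁ ∈ secantQuotientServedClassesPinned Y θ,
        γ₁ ∈ Summit.HodgeConjecture.HodgeConjecture.Ring2.AbelianAll.carriedClasses
          (twistedReflexiveClass C (fun n X₀ I E => Summit.Ventures.HSemireg.gluableSigmaAdmissible n X₀ I E ∨ bfSingleAdmissible' n X₀ I E)) 6 3 Y θ) :
    SecantQuotientPinnedAnchorLevelTransfer63PinnedPrime C :=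
  pinnedLevelTransfer63_of_oneCarried_63_pinned h

/-- **MODULO L1″(C, AdmTw′): stub 2a′₀ at `C` ⟺ G1♭′(C) — EXACTLY.** Kernel-side the registered stub is print's pinned claim plus the tree's named
one-direction same-level transfer node `SecantQuotientPinnedAnchorLevelTransfer63PinnedPrime C`, nothing more and nothing less.
[cite: Markman2025SecantWeil, Thm. 1.4.1 (item 4), §1.5, Thm. 1.5.1 and §9.3 Lemma 9.3.11] [cite: Bloch1972Semiregularity, Remark (7.5)] -/
theorem oneCarried_63_twPrime_iff_pinnedLevelTransfer63PinnedPrime_of_markmanPinned (C : ChernCharacterBetti)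
    (hM : Markman2025_secantQuotient_twistedCarrier_onJacobian_pinned C
      (fun n X₀ I E => Summit.Ventures.HSemireg.gluableSigmaAdmissible n X₀ I E ∨ bfSingleAdmissible' n X₀ I E)) :
    (∀ (Y : SchemeOver ℂ) (θ : complexBetti Y 2), secantQuotientAnchorsPinned Y θ →
      ∃ γ₁ ∈ secantQuotientServedClassesPinned Y θ,
        γ₁ ∈ Summit.HodgeConjecture.HodgeConjecture.Ring2.AbelianAll.carriedClasses
          (twistedReflexiveClass C (fun n X₀ I E => Summit.Ventures.HSemireg.gluableSigmaAdmissible n X₀ I E ∨ bfSingleAdmissible' n X₀ I E)) 6 3 Y θ) ↔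
      SecantQuotientPinnedAnchorLevelTransfer63PinnedPrime C :=
  oneCarried_63_pinned_iff_pinnedLevelTransfer63_of_markmanPinned hM

/-- **The `∀ C` form with THE REGISTERED STUB'S TYPE as conclusion** (syntactic guard: the conclusion is `stub_oneCarried_63_secantQuotientPinnedPrime`'s
statement byte-for-byte): `(∀ C, L1″(C, AdmTw′)) ∧ (∀ C, G1♭′(C)) ⟹ 2a′₀`. Both hypotheses OPEN; nothing asserted.
[cite: Markman2025SecantWeil, Thm. 1.4.1 (item 4), §1.5 and §9.3 Lemma 9.3.11] [cite: Bloch1972Semiregularity, Remark (7.5)] -/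
theorem forall_oneCarried_63_twPrime_of_markmanPinned_of_pinnedLevelTransfer
    (hM : ∀ C : ChernCharacterBetti, Markman2025_secantQuotient_twistedCarrier_onJacobian_pinned C
      (fun n X₀ I E => Summit.Ventures.HSemireg.gluableSigmaAdmissible n X₀ I E ∨ bfSingleAdmissible' n X₀ I E))
    (hG1 : ∀ C : ChernCharacterBetti, SecantQuotientPinnedAnchorLevelTransfer63PinnedPrime C) :
    ∀ C : ChernCharacterBetti,
    ∀ (Y : SchemeOver ℂ) (θ : complexBetti Y 2), secantQuotientAnchorsPinned Y θ →
      ∃ γ₁ ∈ secantQuotientServedClassesPinned Y θ,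
        γ₁ ∈ Summit.HodgeConjecture.HodgeConjecture.Ring2.AbelianAll.carriedClasses
          (twistedReflexiveClass C (fun n X₀ I E => Summit.Ventures.HSemireg.gluableSigmaAdmissible n X₀ I E ∨ bfSingleAdmissible' n X₀ I E)) 6 3 Y θ :=
  fun C ↦ oneCarried_63_twPrime_of_markmanPinned_of_pinnedLevelTransfer C (hM C) (hG1 C)

/-- Via lane R's G1′ (`SecantQuotientAnchorLevelTransfer63PinnedPrime C`, unrestricted targets; G1′ ⟹ G1♭′): L1″(C, AdmTw′) ∧ G1′(C) ⟹ 2a′₀(C).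
[cite: Markman2025SecantWeil, Thm. 1.4.1 (item 4) and Thm. 1.5.1] [cite: Bloch1972Semiregularity, Remark (7.5)] -/
theorem oneCarried_63_twPrime_of_markmanPinned_of_levelTransfer63PinnedPrime (C : ChernCharacterBetti)
    (hM : Markman2025_secantQuotient_twistedCarrier_onJacobian_pinned C
      (fun n X₀ I E => Summit.Ventures.HSemireg.gluableSigmaAdmissible n X₀ I E ∨ bfSingleAdmissible' n X₀ I E))
    (hG1 : SecantQuotientAnchorLevelTransfer63PinnedPrime C) :
    ∀ (Y : SchemeOver ℂ) (θ : complexBetti Y 2), secantQuotientAnchorsPinned Y θ →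
      ∃ γ₁ ∈ secantQuotientServedClassesPinned Y θ,
        γ₁ ∈ Summit.HodgeConjecture.HodgeConjecture.Ring2.AbelianAll.carriedClasses
          (twistedReflexiveClass C (fun n X₀ I E => Summit.Ventures.HSemireg.gluableSigmaAdmissible n X₀ I E ∨ bfSingleAdmissible' n X₀ I E)) 6 3 Y θ :=
  oneCarried_63_twPrime_of_markmanPinned_of_pinnedLevelTransfer C hM (pinnedLevelTransfer63_of_levelTransfer63 hG1)

/-- Via ring2-b03x's primed node (`SecantQuotientWeilDirectionTransfer63PinnedPrime C` = G1♭′ ∧ G3′): L1″(C, AdmTw′) ∧ node′(C) ⟹ 2a′₀(C) — the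
one-direction shadow of `secantQuotientAnchorCarrier63PinnedPrime_of_pinned_of_weilDirectionTransfer`. [cite: Markman2025SecantWeil, Thm. 1.4.1 (item 4) and Thm. 1.5.1]
[cite: Bloch1972Semiregularity, Remark (7.5)] -/
theorem oneCarried_63_twPrime_of_markmanPinned_of_weilDirectionTransfer63PinnedPrime (C : ChernCharacterBetti)
    (hM : Markman2025_secantQuotient_twistedCarrier_onJacobian_pinned C
      (fun n X₀ I E => Summit.Ventures.HSemireg.gluableSigmaAdmissible n X₀ I E ∨ bfSingleAdmissible' n X₀ I E))
    (hN : SecantQuotientWeilDirectionTransfer63PinnedPrime C) :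
    ∀ (Y : SchemeOver ℂ) (θ : complexBetti Y 2), secantQuotientAnchorsPinned Y θ →
      ∃ γ₁ ∈ secantQuotientServedClassesPinned Y θ,
        γ₁ ∈ Summit.HodgeConjecture.HodgeConjecture.Ring2.AbelianAll.carriedClasses
          (twistedReflexiveClass C (fun n X₀ I E => Summit.Ventures.HSemireg.gluableSigmaAdmissible n X₀ I E ∨ bfSingleAdmissible' n X₀ I E)) 6 3 Y θ :=
  oneCarried_63_twPrime_of_markmanPinned_of_pinnedLevelTransfer C hM (pinnedLevelTransfer63_of_weilDirectionTransfer63 hN)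

/-- Via the hyperelliptic split (`…OffHyperellipticPinnedPrime C` ∧ `…AtHyperellipticPinnedPrime C` ⟺ G1♭′(C)): L1″(C, AdmTw′) ∧ Off′(C) ∧ At′(C) ⟹
2a′₀(C) — the stub's content beyond print read in ∀-form is the AT-HYPERELLIPTIC closedness case. [cite: Markman2025SecantWeil, §9 (p. 57), Thm. 1.4.1 (item 4) and §9.3 Lemma 9.3.11]
[cite: Bloch1972Semiregularity, Remark (7.5)] -/
theorem oneCarried_63_twPrime_of_markmanPinned_of_offHyperelliptic_of_atHyperelliptic (C : ChernCharacterBetti)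
    (hM : Markman2025_secantQuotient_twistedCarrier_onJacobian_pinned C
      (fun n X₀ I E => Summit.Ventures.HSemireg.gluableSigmaAdmissible n X₀ I E ∨ bfSingleAdmissible' n X₀ I E))
    (hoff : SecantQuotientPinnedAnchorLevelTransfer63OffHyperellipticPinnedPrime C)
    (hat : SecantQuotientPinnedAnchorLevelTransfer63AtHyperellipticPinnedPrime C) :
    ∀ (Y : SchemeOver ℂ) (θ : complexBetti Y 2), secantQuotientAnchorsPinned Y θ →
      ∃ γ₁ ∈ secantQuotientServedClassesPinned Y θ,
        γ₁ ∈ Summit.HodgeConjecture.HodgeConjecture.Ring2.AbelianAll.carriedClasses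
          (twistedReflexiveClass C (fun n X₀ I E => Summit.Ventures.HSemireg.gluableSigmaAdmissible n X₀ I E ∨ bfSingleAdmissible' n X₀ I E)) 6 3 Y θ :=
  oneCarried_63_twPrime_of_markmanPinned_of_pinnedLevelTransfer C hM
    (pinnedLevelTransfer63_of_offHyperelliptic_of_atHyperelliptic hoff hat)

/-- **v3.3's stub 2a‴ ⟹ 2a′₀, unconditionally** (`SecantQuotientAnchorCarrier63PinnedPrime C`: every pinned anchor × every rational pinned-served
direction carried ⟹ some pinned-served class carried at every pinned anchor) — the stronger single-carrier form named at the foot of skeleton v3.6.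
[cite: Markman2025SecantWeil, Thm. 1.4.1 (item 4)] [cite: Bloch1972Semiregularity, Remark (7.5)] -/
theorem oneCarried_63_twPrime_of_secantQuotientAnchorCarrier63PinnedPrime (C : ChernCharacterBetti)
    (h : SecantQuotientAnchorCarrier63PinnedPrime C) :
    ∀ (Y : SchemeOver ℂ) (θ : complexBetti Y 2), secantQuotientAnchorsPinned Y θ →
      ∃ γ₁ ∈ secantQuotientServedClassesPinned Y θ,
        γ₁ ∈ Summit.HodgeConjecture.HodgeConjecture.Ring2.AbelianAll.carriedClasses
          (twistedReflexiveClass C (fun n X₀ I E => Summit.Ventures.HSemireg.gluableSigmaAdmissible n X₀ I E ∨ bfSingleAdmissible' n X₀ I E)) 6 3 Y θ :=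
  oneCarried_63_pinned_of_anchoredCarrierAt_pinned h

/-! ## §4 The F7 chain of skeleton v3.6 keyed by name: L1″ ∧ G1♭′ ∧ 2m′ ⟹ 2s′ -/

/-- **2s′ FROM PRINT, THE ONE-DIRECTION TRANSFER NODE AND THE MOVER: L1″(C, AdmTw′) ∧ G1♭′(C) ∧ 2m′(C) ⟹ the span statement 2s′ at `C`**
(`AnchoredSpanAt (tw C AdmTw′) 6 3 𝔄^pin 𝔖^pin (𝔖^pin + ℂθ³)`, the derived `anchoredSpan_63_secantQuotientPinnedPrime_of_stubs` of skeleton v3.6) — ring2-b03x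
g7's F7 composition `anchoredSpanAt_pinned_twPrime_of_oneCarried_of_secondCarried` with 2a′₀ supplied by §3. All three inputs OPEN, hypotheses here.
[cite: Markman2025SecantWeil, Thm. 1.4.1 (item 4), §1.5 and §9.3 Lemma 9.3.11] [cite: Bloch1972Semiregularity, Remark (7.5)] -/
theorem anchoredSpanAt_pinned_twPrime_of_markmanPinned_of_pinnedLevelTransfer_of_secondCarried (C : ChernCharacterBetti)
    (hM : Markman2025_secantQuotient_twistedCarrier_onJacobian_pinned C
      (fun n X₀ I E => Summit.Ventures.HSemireg.gluableSigmaAdmissible n X₀ I E ∨ bfSingleAdmissible' n X₀ I E))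
    (hG1 : SecantQuotientPinnedAnchorLevelTransfer63PinnedPrime C)
    (h₂ : ∀ (Y : SchemeOver ℂ) (θ : complexBetti Y 2), secantQuotientAnchorsPinned Y θ →
      ∀ γ₁ ∈ secantQuotientServedClassesPinned Y θ,
        γ₁ ∈ carriedClasses (twistedReflexiveClass C (fun n X₀ I E => Summit.Ventures.HSemireg.gluableSigmaAdmissible n X₀ I E ∨
          bfSingleAdmissible' n X₀ I E)) 6 3 Y θ →
        ∃ γ₂ ∈ secantQuotientServedClassesPinned Y θ,
          γ₂ ∈ carriedClasses (twistedReflexiveClass C (fun n X₀ I E => Summit.Ventures.HSemireg.gluableSigmaAdmissible n X₀ I E ∨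
            bfSingleAdmissible' n X₀ I E)) 6 3 Y θ ∧
          ∀ γ ∈ secantQuotientServedClassesPinned Y θ, ∃ x y z : ℂ, γ = x • γ₁ + y • γ₂ + z • cupPowTwo θ 3) :
    AnchoredSpanAt (twistedReflexiveClass C (fun n X₀ I E => Summit.Ventures.HSemireg.gluableSigmaAdmissible n X₀ I E ∨
        bfSingleAdmissible' n X₀ I E)) 6 3
      (fun Y θ ↦ secantQuotientAnchorsPinned Y θ) (fun Y θ ↦ secantQuotientServedClassesPinned Y θ)
      (fun Y θ ↦ {w : complexBetti Y (2 * 3) |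
        ∃ γ, (γ = 0 ∨ γ ∈ secantQuotientServedClassesPinned Y θ) ∧ ∃ z : ℂ, w = γ + z • cupPowTwo θ 3}) :=
  anchoredSpanAt_pinned_twPrime_of_oneCarried_of_secondCarried C
    (oneCarried_63_twPrime_of_markmanPinned_of_pinnedLevelTransfer C hM hG1) h₂

end TwPrime

#print axioms oneCarried_63_pinned_iff_pinnedLevelTransfer63_of_seeds
#print axioms oneCarried_63_twPrime_of_markmanPinned_of_pinnedLevelTransfer
#print axioms oneCarried_63_twPrime_iff_pinnedLevelTransfer63PinnedPrime_of_markmanPinned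
#print axioms anchoredSpanAt_pinned_twPrime_of_markmanPinned_of_pinnedLevelTransfer_of_secondCarried

end Summit.HodgeConjecture.HodgeConjecture.Ring2.SemiregularRepresentatives

end
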